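import Literature.AnabelianGeometry.EtaleTheta.Discharge.Sec5ThetaProperHThetaSmallIndex
import Literature.AnabelianGeometry.EtaleTheta.ThetaProperFractionPairSmallIndexYdd
import Literature.AnabelianGeometry.EtaleTheta.Discharge.Sec5FirstDatumThetaTwistTower
import Literature.AnabelianGeometry.EtaleTheta.Discharge.Sec5RootDivisorInvarianceOfKernel
import HarnessLib

/-!
# [EtTh] §5 p.330–331 / Prop. 4.3 (i), FIRST FORM (Prop. 5.2 (i): ONE root of the theta function's fraction-pair on `A_⊙`): the divisor
# binders `hinvc` / `hinvp` of abc-iut-L2-t3's `ofQuotientTemperoidRootData` DISCHARGED at the theta data of record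

S. Mochizuki, *The étale theta function …*, Publ. RIMS **45** (2009) [MochizukiEtTh2009], §5 p.330 (PDF p.104) («the zero divisor `Div(s^⊓_N)` …
descends»), Prop. 4.3 (i) proof p.317 (PDF p.91) («`H` acts trivially on `A_⊙^bs` [together with the fact the monoid `Φ(A_N)` is torsion-free!]»),
Prop. 5.2 (i) p.324 (PDF p.98) (FIRST form: «an `l·N`-th root of a right fraction-pair of `Θ̈`»), Def. 4.1 (ii) p.313 (PDF p.87).
[cite: MochizukiEtTh2009, §5 p.330 (PDF p.104)]  PAGE CONVENTION for [EtTh]: «printed N (PDF p.M)», N = M + 226.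

PROOF-ONLY (theorems only; abc-iut cell, layer L2, seat abc-iut-L2-d2 gen 8; abc-iut-L2-lead R1381 (ii) / R1385: the «divisor-hypothesis twins,
FIRST FORM» — PRIORITY 1 inputs of abc-iut-L2-t4's junction FILE 2 and abc-iut-L2-t12's FILE-1 twin, consumed BY NAME as the binders `hinvc` /
`hinvp` of abc-iut-L2-t3's `ThetaFrobenioid.ofQuotientTemperoidRootData` (`Discharge/Sec5OfQuotientTemperoidRootData`) at a SINGLE root `R : S.NthRoot θ Pl M` of the theta
function's fraction-pair).  The nested S-anchored pair is EMPTY at the tower sockets (this seat's `isEmpty_nthRoot_nested_theta`, p518033), so the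
earlier nested instances (`hinvc_theta` p509012, `hinvc/hinvp_thetaProper` p513262) are vacuous there; THESE are the inhabited ones.  Consumed BY
NAME, nothing restated: abc-iut-L2-t4's `NthRoot.pull_aut_div_num` (`Discharge/Sec5RootDivisorInvariance`), abc-iut-L2-t3's
`NthRoot.pull_galoisSurj_div_den_of_mem` / `pull_galoisSurj_Aodot_of_mem_Hodot` (`Sec5RootDivisorInvarianceOfKernel`), `settingSmall` /
`settingSmallYdd` / `hH_settingSmallYdd` / `isDivisorial_small` / `settingSmall_galoisSurjNatural` (p501267/p504077), abc-iut-L2-t4's `settingTheta`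
/ `hH_settingTheta_of_forall_mem` / `isDivisorial_full` / `settingTheta_galoisSurjNatural` (p513309), this seat's `hθ_thetaProperNum` (p513262),
`hθ_thetaNum` (p509012), `thetaProperUnitQuot` / `thetaProperFractionPairQuot` (p512057), `thetaProperUnitYdd` / `thetaProperFractionPairYdd` (p514011),
`thetaUnit` / `thetaFractionPair` (p507274).
* §1 GENERIC (any `BiKummerSetting`, any single root `R : S.NthRoot f P M`): **`ThetaFrobenioid.hinvp_root_of_hH`** — `hinvp ⟸ hH := ιX(Π^tp_Ÿ) ⊆ H_⊙`
  ALONE (one propagation step of abc-iut-L2-t3's kernel argument; no hypothesis on `Div(s″)`); pointed over `y : Π^tp_Ÿ` as a subtype element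
  (feed `fun y hy => … ⟨y, hy⟩` to the constructor's `∀ y, y ∈ Π^tp_Ÿ → …` binder).
* §2 CARRIER OF RECORD (`settingSmall R S X φ hφ NH M`, `M ≤ Ker φ₃`; `settingSmallYdd`): **`hinvc_thetaProperRoot`** (every `Aut(A_M^bs)` fixes
  `Div(s^⊓)` — from `hθ_thetaProperNum`), **`hinvp_thetaProperRoot`** (`⟸ hH`), **`hinvc_thetaProperRootYdd`** / **`hinvp_thetaProperRootYdd`** (at the
  Ÿ-anchor: `hH` a THEOREM, so `hinvp` has NO hypothesis beyond the display clause `hY` that types the datum).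
* §3 FOURTH MODEL (`settingTheta R S n X φ hφ`, anchor `(Compat₃′/V_n, 0)`): **`hinvc_thetaRoot`**, **`hinvp_thetaRoot_of_hM`** (`⟸` the level clause
  `hM : φ(ιX(Π^tp_Ÿ)) ⊆ V_n`).
Every theorem is stated for EVERY order `M` (so `M := l·N` of the first form, with the roots INHABITED by `nonempty_nthRoot_theta` p509012 /
`nonempty_nthRoot_settingSmallYdd` p512762) and EVERY transport datum `pullFrac`.  HONEST FRAMING: class-(b) combinatorial DESIGN carriers;
onto-socket design-only (R1257); `hY` / `hM` / `hH` are the displayed clauses named; nothing here bears on [IUTchIII] Cor. 3.12; no side taken;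
typed ≠ proved.
-/

noncomputable section

namespace Literature.AnabelianGeometry.EtaleTheta

open CategoryTheory Opposite Function Literature.AlgebraicGeometry.Frobenioids Literature.AlgebraicGeometry.Frobenioids.QuasiTemperoid
  Literature.AnabelianGeometry.SemiGraphs LogDivisorModel LogDivisorModel.GaloisAction LogDivisorTower TateTowerKummerTwistRShear
  LogDivisorModel.TateTowerThetaTwist

universe u₀ v₀ u v w

/-! ## §1 Generic: `hinvp` for a single root from `hH` alone -/

namespace ThetaFrobenioid

variable {K : Type u₀} [Field K] {X : SemiGraphs.TemperedArithmeticGroup.{u₀} K} {D₀ : Type u₀} [Category.{v₀} D₀]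
  {V : FrdIMonoidStub.{w}} {T₀ : RealifiedDivisorMonoids (D₀ := D₀) V} {D : Type u} [Category.{v} D]
  {VD : FrdICatStub.{u, v, w} D} {S : BiKummerSetting X T₀ D VD}
  {pullFrac : ∀ {A A' : S.C} (_ : A' ⟶ A), S.biratUnits A → S.biratUnits A'}
  {M N : ℕ+} {T : ThetaEnvData.{max v w} N} {θ : S.biratUnits S.Aodot} {Bl : S.C} {Pl : S.FractionPair θ Bl}
  (R : S.NthRoot θ Pl M pullFrac) (ιX : T.PiX ≃ₜ* X.Pi)
  (hΦd : Objectwise (fun M _ => IsDivisorial M) S.tf.divisorMonoid)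
  (hS : ∀ ⦃A' B' : D⦄ (hA' : S.IsGaloisObj A') (hB' : S.IsGaloisObj B') (b : B' ⟶ A'),
    ∃ c : X.Pi, ∀ g : X.Pi, (S.galoisSurj B' hB' g).hom ≫ b = b ≫ (S.galoisSurj A' hA' (c * g * c⁻¹)).hom)

include hΦd hS in
/-- **`hinvp` for a SINGLE root `A_⊙ ← A_M` from `hH` alone** (Prop. 4.3 (i) proof p.317 as printed: `H_⊙ = Ker ρ_{A_⊙}` acts trivially on
`A_⊙^bs`, and `H_⊙`-stability propagates along the root since `Φ(A_M)` is torsion-free and the outer naturality conjugates inside the normal `H_⊙`):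
`Φ(ρ_{A_M}(ιX y))(Div s^⊔) = Div s^⊔` for every `y ∈ Π^tp_Ÿ`, with NO hypothesis on `Div(s″)`. [cite: MochizukiEtTh2009, Prop 4.3 (i) p.317 (PDF p.91)] -/
theorem hinvp_root_of_hH (hH : ∀ y : T.PiX, y ∈ T.PiYdd → ιX y ∈ S.Hodot) (y : T.PiYdd) :
    pull S.tf.divisorMonoid (S.galoisSurj R.AN.base R.αData.isGalois (ιX y.1)).hom (ModelFrobenioid.div R.pair.den) =
      ModelFrobenioid.div R.pair.den :=
  haveI : S.Hodot.Normal := by unfold BiKummerSetting.Hodot; infer_instance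
  BiKummerSetting.NthRoot.pull_galoisSurj_div_den_of_mem R S.isGalois_Aodot hΦd hS S.Hodot
    (fun _ hx => S.pull_galoisSurj_Aodot_of_mem_Hodot hx _) (ιX y.1) (hH y.1 y.2)

end ThetaFrobenioid

/-! ## §2 The carrier of record: `settingSmall … M` (`M ≤ Ker φ₃`) and the Ÿ-anchor `settingSmallYdd` -/

namespace ThetaTwistTowerSmallIndex

open ThetaTwistTowerTempered

variable (R S : ((ConnectedPart (BTemp (Compat 3 thetaShear)))ᵒᵖ ⥤ CommMonCat.{0}) → Prop) {K : Type} [Field K]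
  (X : SemiGraphs.TemperedArithmeticGroup.{0} K) (NH : Subgroup (Field.absoluteGaloisGroup K) → (temperedFrobenioidSmall R S).category → ℕ+ → Prop)
  (φ : X.Pi →ₜ* Compat 3 thetaShear) (hφ : Function.Surjective φ)

section Quot

variable (M : OpenNormalSubgroup (Compat 3 thetaShear)) (hM : ∀ g ∈ M.toSubgroup, φ₃ g = 1)
  {pullFrac : ∀ {B B' : (settingSmall R S X φ hφ NH M).C} (_ : B' ⟶ B),
    (settingSmall R S X φ hφ NH M).biratUnits B → (settingSmall R S X φ hφ NH M).biratUnits B'}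
  {M' N' : ℕ+} {T : ThetaEnvData.{0} N'} (ιX : T.PiX ≃ₜ* X.Pi)
  (Rt : (settingSmall R S X φ hφ NH M).NthRoot (thetaProperUnitQuot R S M hM) (thetaProperFractionPairQuot R S X NH φ hφ M hM) M' pullFrac)

/-- **`hinvc`, FIRST FORM, carrier of record**: for every single root `A_⊙ ← A_{M′}` of the theta function's fraction-pair in
`settingSmall R S X φ hφ NH M` (`M ≤ Ker φ₃`; any order, any `pullFrac`), EVERY `g ∈ Aut_D(A_{M′}^bs)` fixes `Div(s^⊓)` (⟸ `hθ_thetaProperNum` +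
abc-iut-L2-t4's `pull_aut_div_num`). [cite: MochizukiEtTh2009, §5 p.330 (PDF p.104)] -/
theorem hinvc_thetaProperRoot (g : Aut Rt.AN.base) :
    pull (temperedFrobenioidSmall R S).divisorMonoid g.hom (ModelFrobenioid.div Rt.pair.num) = ModelFrobenioid.div Rt.pair.num :=
  BiKummerSetting.NthRoot.pull_aut_div_num Rt (settingSmall R S X φ hφ NH M).isGalois_Aodot (fun W => isDivisorial_small R S W)
    (settingSmall_galoisSurjNatural R S X φ hφ NH M) (hθ_thetaProperNum R S X NH φ hφ M hM) g

/-- **`hinvp`, FIRST FORM, carrier of record, from `hH` alone.** [cite: MochizukiEtTh2009, Prop 4.3 (i) p.317 (PDF p.91)] -/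
theorem hinvp_thetaProperRoot (hH : ∀ y : T.PiX, y ∈ T.PiYdd → ιX y ∈ (settingSmall R S X φ hφ NH M).Hodot) (y : T.PiX) (hy : y ∈ T.PiYdd) :
    pull (temperedFrobenioidSmall R S).divisorMonoid
        ((settingSmall R S X φ hφ NH M).galoisSurj Rt.AN.base Rt.αData.isGalois (ιX y)).hom (ModelFrobenioid.div Rt.pair.den) =
      ModelFrobenioid.div Rt.pair.den :=
  ThetaFrobenioid.hinvp_root_of_hH Rt ιX (fun W => isDivisorial_small R S W) (settingSmall_galoisSurjNatural R S X φ hφ NH M) hH ⟨y, hy⟩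

end Quot

section Ydd

variable {N : ℕ+} (T : ThetaEnvData.{0} N) (ιX : T.PiX ≃ₜ* X.Pi) (hY : ∀ y : T.PiX, y ∈ T.PiYdd → φ₃ (φ (ιX y)) = 1)
  {pullFrac : ∀ {B B' : (settingSmallYdd R S X φ hφ NH T ιX).C} (_ : B' ⟶ B),
    (settingSmallYdd R S X φ hφ NH T ιX).biratUnits B → (settingSmallYdd R S X φ hφ NH T ιX).biratUnits B'}
  {M' : ℕ+}
  (Rt : (settingSmallYdd R S X φ hφ NH T ιX).NthRoot (thetaProperUnitYdd R S X φ hφ NH T ιX hY)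
    (thetaProperFractionPairYdd R S X φ hφ NH T ιX hY) M' pullFrac)

/-- **`hinvc`, FIRST FORM, at the Ÿ-ANCHOR of record** (`settingSmallYdd`; datum `thetaProperFractionPairYdd` under the display clause `hY`; any
order — e.g. `l·N` with the root from abc-iut-L2-t3's `nonempty_nthRoot_settingSmallYdd`). [cite: MochizukiEtTh2009, §5 p.330 (PDF p.104)] -/
theorem hinvc_thetaProperRootYdd (g : Aut Rt.AN.base) :
    pull (temperedFrobenioidSmall R S).divisorMonoid g.hom (ModelFrobenioid.div Rt.pair.num) = ModelFrobenioid.div Rt.pair.num :=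
  hinvc_thetaProperRoot R S X NH φ hφ _ (φ₃_eq_one_of_mem_yddImage X φ hφ T ιX hY) Rt g

/-- **`hinvp`, FIRST FORM, at the Ÿ-ANCHOR of record — NO hypothesis beyond the datum's display clause** (`hH` is abc-iut-L2-t3's THEOREM
`hH_settingSmallYdd`). [cite: MochizukiEtTh2009, Prop 4.3 (i) p.317 (PDF p.91); §5 p.331 (PDF p.105)] -/
theorem hinvp_thetaProperRootYdd (y : T.PiX) (hy : y ∈ T.PiYdd) :
    pull (temperedFrobenioidSmall R S).divisorMonoid
        ((settingSmallYdd R S X φ hφ NH T ιX).galoisSurj Rt.AN.base Rt.αData.isGalois (ιX y)).hom (ModelFrobenioid.div Rt.pair.den) =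
      ModelFrobenioid.div Rt.pair.den :=
  hinvp_thetaProperRoot R S X NH φ hφ _ (φ₃_eq_one_of_mem_yddImage X φ hφ T ιX hY) ιX Rt (hH_settingSmallYdd R S X φ hφ NH T ιX) y hy

end Ydd

end ThetaTwistTowerSmallIndex

/-! ## §3 The fourth model's own socket `settingTheta R S n X φ hφ` -/

namespace ThetaTwistTowerTempered

variable (R S : ((ConnectedPart (BTemp (Compat 3 thetaShear)))ᵒᵖ ⥤ CommMonCat.{0}) → Prop) (n : ℕ) {K : Type 1} [Field K]
  (X : SemiGraphs.TemperedArithmeticGroup.{1} K) (φ : X.Pi →ₜ* Compat 3 thetaShear) (hφ : Function.Surjective φ)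
  {pullFrac : ∀ {A A' : (ThetaTwistTowerTempered.temperedFrobenioid R S).category} (_ : A' ⟶ A),
    (ThetaTwistTowerTempered.temperedFrobenioid R S).biratUnitsModel A → (ThetaTwistTowerTempered.temperedFrobenioid R S).biratUnitsModel A'}
  {M' N' : ℕ+} {T : ThetaEnvData.{0} N'} (ιX : T.PiX ≃ₜ* X.Pi)
  (Rt : (settingTheta R S n X φ hφ).NthRoot (thetaUnit R S n)
    (thetaFractionPair R S n X _ _ _ (fun _ _ _ => True) _ (isFrobeniusTrivial_Aodot R S n) (isGaloisObj_Aodot_base R S n)) M' pullFrac)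

/-- **`hinvc`, FIRST FORM, fourth model**: every `g ∈ Aut_D(A_{M′}^bs)` fixes `Div(s^⊓)` for every single root of (`thetaUnit n`, `thetaFractionPair n`)
(any order — e.g. `l·N`, inhabited by `nonempty_nthRoot_theta` p509012 — any `pullFrac`). [cite: MochizukiEtTh2009, §5 p.330 (PDF p.104)] -/
theorem hinvc_thetaRoot (g : Aut Rt.AN.base) :
    pull (ThetaTwistTowerTempered.temperedFrobenioid R S).divisorMonoid g.hom (ModelFrobenioid.div Rt.pair.num) = ModelFrobenioid.div Rt.pair.num :=
  BiKummerSetting.NthRoot.pull_aut_div_num Rt (settingTheta R S n X φ hφ).isGalois_Aodot (fun W => isDivisorial_full R S W)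
    (settingTheta_galoisSurjNatural R S n X φ hφ) (hθ_thetaNum R S n X φ hφ) g

/-- **`hinvp`, FIRST FORM, fourth model, from `hH`.** [cite: MochizukiEtTh2009, Prop 4.3 (i) p.317 (PDF p.91)] -/
theorem hinvp_thetaRoot_of_hH (hH : ∀ y : T.PiX, y ∈ T.PiYdd → ιX y ∈ (settingTheta R S n X φ hφ).Hodot) (y : T.PiYdd) :
    pull (ThetaTwistTowerTempered.temperedFrobenioid R S).divisorMonoid
        ((settingTheta R S n X φ hφ).galoisSurj Rt.AN.base Rt.αData.isGalois (ιX y.1)).hom (ModelFrobenioid.div Rt.pair.den) =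
      ModelFrobenioid.div Rt.pair.den :=
  ThetaFrobenioid.hinvp_root_of_hH Rt ιX (fun W => isDivisorial_full R S W) (settingTheta_galoisSurjNatural R S n X φ hφ) hH y

/-- **`hinvp`, FIRST FORM, fourth model, from the level clause `hM : φ(ιX(Π^tp_Ÿ)) ⊆ V_n` alone** (pointed form `y : Π^tp_Ÿ` as a subtype
element; feed `fun y hy => hinvp_thetaRoot_of_hM … ⟨y, hy⟩` to the constructor's binder). [cite: MochizukiEtTh2009, Prop 4.3 (i) p.317 (PDF p.91)] -/
theorem hinvp_thetaRoot_of_hM (hM : ∀ y : T.PiX, y ∈ T.PiYdd → φ (ιX y) ∈ vOpenNormal 3 thetaShear n) (y : T.PiYdd) :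
    pull (ThetaTwistTowerTempered.temperedFrobenioid R S).divisorMonoid
        ((settingTheta R S n X φ hφ).galoisSurj Rt.AN.base Rt.αData.isGalois (ιX y.1)).hom (ModelFrobenioid.div Rt.pair.den) =
      ModelFrobenioid.div Rt.pair.den :=
  hinvp_thetaRoot_of_hH R S n X φ hφ ιX Rt (hH_settingTheta_of_forall_mem R S n X φ hφ ιX T.PiYdd hM) y

end ThetaTwistTowerTempered

end Literature.AnabelianGeometry.EtaleTheta

end
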